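import Literature.NumberTheory.Weil1982.CayleyWindowCentralizerData                        -- ★ (Q3) LH3-p04: `cayley_unitary_comm_of_valBound`, `exists_skew_cayley_eq_of_le`, `valBound_smul` (brings ★ C2 `eq_of_cayley_eq_cayley`, …)
import Literature.NumberTheory.GaloisRepresentations.StableLatticeValuationRing             -- ★ `exists_conj_mem_range_generalLinearGroup_map_of_valuationSubring`
import Mathlib.NumberTheory.LocalField.Basic
import Mathlib.Topology.Algebra.Module.FiniteDimension
import HarnessLib

/-!
# F0 · P3c · line LH6 «StCharTS» — WIF antecedent, ELLIPTIC half: brick (C8b-frame) «THE CONJUGATED CAYLEY FRAME OF `U(σ,J)(K)` AND ITS SCALARS»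

Cell `pub/hodgecm-mathlib`, crux H413 = `stmt-HodgeConjecture-24833` (lane `--supports … --as helper`); seat LH5-p02 (g6); ROAD «JAC-ELL» v1 §3 hazards (a)–(c):
the model-side lemmas that feed ★ (C4u) `exists_cayley_chart_haar` with the CONJUGATED embedding `X ↦ P⁻¹XP` (so that a compact Cartan subgroup becomes
integral), the rational structure on `𝔲(σ,J) = {X | σ(X)ᵀJ + JX = 0}` (for ★ (Q8)'s Cartan decomposition at `F = ℚ`), and a `σ`-fixed scalar of valuation `< 1`
(the residue characteristic) for ★ (Q11)'s uniform level shifts.  THEOREMS ONLY; Mathlib + ★ (Q3) + ★ `StableLatticeValuationRing`.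

* §1 `continuous_linearMap_matrix` — every `K`-linear endomorphism of `M_n(K)` is continuous (`K` a topological ring).
* §2 `map_inv_mul_map`, `skew_conj_iff`, `unitary_conj_iff` — with `J′ = σ(P)ᵀ J P`: `P⁻¹XP` is `J′`-skew iff `X` is `J`-skew; `P⁻¹gP` is `J′`-unitary iff `g` is `J`-unitary.
* §3 `exists_ratSubmodule_skew` (`𝔲` as a `ℚ`-submodule, `σ` fixes `ℚ`), `exists_smul_addEquiv` (scaling by a non-zero natural number on `𝔲`),
  `exists_natCast_valuation_lt_one` (a natural number `q` with `0 < |q|_K < 1` in a characteristic-zero local field: the residue characteristic).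
* §4 `exists_conj_valBound_one` — a compact subgroup of `GL_n(K)` is conjugate into the integral matrices (★ `StableLatticeValuationRing`).
* §5 `valBound_cayley_sub_one`, `comm_of_cayley_comm` — inside the Cayley window, `cayley W` commutes with `x` only if `W` does (★ Q3).

HONEST LABEL: count-neutral helper algebra; closes no organ; HC_CM is proved only modulo the printed citations (h413 = `stmt-HodgeConjecture-24833`) until rung 0 closes.

## References
* [PlatonovRapinchuk1994] V. Platonov, A. Rapinchuk, *Algebraic Groups and Number Theory* (1994), §3.3 (Cayley map, congruence filtrations; compact subgroups
  of `GL_n` over local fields are conjugate into `GL_n(𝒪)`). Context locator.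
* [Serre1992LALG] J.-P. Serre, *Lie Algebras and Lie Groups*, LNM 1500 (1992), Part II Ch. IV §8–§9. Context locator.
-/

set_option autoImplicit false
set_option linter.dupNamespace false

open Set Filter TopologicalSpace Topology Matrix ValuativeRel
open Literature.NumberTheory.Automorphic Literature.NumberTheory.Weil1982.UnitaryFinTopForm
open scoped Pointwise Topology MatrixGroups ValuativeRel

namespace Summit.HodgeConjecture.HodgeConjecture.Cruxes.H413.F0P3cStCharTSJacCartanModelFrame

/-! ## §1 Linear maps of matrices are continuous -/

section Linear

variable {K : Type*} [Field K] [TopologicalSpace K] [IsTopologicalRing K] {n : Type*} [Fintype n]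

/-- **Every `K`-linear endomorphism of `M_n(K)` is continuous** (finite sum of coordinate projections times constants). [cite: Serre1992LALG, Part II Ch. IV §9] -/
theorem continuous_linearMap_matrix (f : Matrix n n K →ₗ[K] Matrix n n K) : Continuous f := by
  -- `M_n(K) ≃ (n × n → K)` linearly and bicontinuously
  let e : (n × n → K) →ₗ[K] Matrix n n K :=
    { toFun := fun v => Matrix.of fun i j => v (i, j), map_add' := fun _ _ => rfl, map_smul' := fun _ _ => rfl }
  have he : Continuous e := by
    refine continuous_matrix fun i j => ?_
    exact continuous_apply (i, j)
  have hu : Continuous fun X : Matrix n n K => fun p : n × n => X p.1 p.2 :=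
    continuous_pi fun p => (continuous_apply p.2).comp (continuous_apply p.1)
  have hfe : Continuous (f ∘ₗ e) := LinearMap.continuous_on_pi _
  have : (f : Matrix n n K → Matrix n n K) = (f ∘ₗ e) ∘ fun X : Matrix n n K => fun p : n × n => X p.1 p.2 := by
    funext X; simp only [Function.comp_apply, LinearMap.coe_comp]; congr 1
  rw [this]
  exact hfe.comp hu

end Linear

/-! ## §2 The conjugated form `J′ = σ(P)ᵀ J P` -/

section Conj

variable {K : Type*} [Field K] {n : Type*} [Fintype n] [DecidableEq n] (σ : K →+* K) (J : Matrix n n K) (P : GL n K)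

/-- `σ(P⁻¹) σ(P) = 1` and `σ(P) σ(P⁻¹) = 1` entrywise. [cite: PlatonovRapinchuk1994, §3.3] -/
theorem map_inv_mul_map : ((P⁻¹ : GL n K) : Matrix n n K).map σ * (P : Matrix n n K).map σ = 1 ∧
    (P : Matrix n n K).map σ * ((P⁻¹ : GL n K) : Matrix n n K).map σ = 1 := by
  constructor
  · rw [← Matrix.map_mul, ← Units.val_mul, inv_mul_cancel, Units.val_one, Matrix.map_one _ (map_zero σ) (map_one σ)]
  · rw [← Matrix.map_mul, ← Units.val_mul, mul_inv_cancel, Units.val_one, Matrix.map_one _ (map_zero σ) (map_one σ)]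

/-- The conjugated skewness defect: `σ(P⁻¹XP)ᵀ J′ + J′ (P⁻¹XP) = σ(P)ᵀ (σ(X)ᵀ J + J X) P`. [cite: PlatonovRapinchuk1994, §3.3] -/
theorem skew_conj_eq (X : Matrix n n K) :
    ((((P⁻¹ : GL n K) : Matrix n n K) * X * (P : Matrix n n K)).map σ)ᵀ * (((P : Matrix n n K).map σ)ᵀ * J * (P : Matrix n n K)) +
      (((P : Matrix n n K).map σ)ᵀ * J * (P : Matrix n n K)) * (((P⁻¹ : GL n K) : Matrix n n K) * X * (P : Matrix n n K)) =
      ((P : Matrix n n K).map σ)ᵀ * ((X.map σ)ᵀ * J + J * X) * (P : Matrix n n K) := by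
  obtain ⟨h1, h2⟩ := map_inv_mul_map σ P
  have h2T : (((P⁻¹ : GL n K) : Matrix n n K).map σ)ᵀ * ((P : Matrix n n K).map σ)ᵀ = 1 := by
    rw [← Matrix.transpose_mul, h2, Matrix.transpose_one]
  have hPP : (P : Matrix n n K) * ((P⁻¹ : GL n K) : Matrix n n K) = 1 := by rw [← Units.val_mul, mul_inv_cancel, Units.val_one]
  rw [Matrix.map_mul, Matrix.map_mul, Matrix.transpose_mul, Matrix.transpose_mul]
  calc ((P : Matrix n n K).map σ)ᵀ * ((X.map σ)ᵀ * (((P⁻¹ : GL n K) : Matrix n n K).map σ)ᵀ) * (((P : Matrix n n K).map σ)ᵀ * J * (P : Matrix n n K)) +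
        ((P : Matrix n n K).map σ)ᵀ * J * (P : Matrix n n K) * (((P⁻¹ : GL n K) : Matrix n n K) * X * (P : Matrix n n K))
      = ((P : Matrix n n K).map σ)ᵀ * (X.map σ)ᵀ * ((((P⁻¹ : GL n K) : Matrix n n K).map σ)ᵀ * ((P : Matrix n n K).map σ)ᵀ) * J * (P : Matrix n n K) +
        ((P : Matrix n n K).map σ)ᵀ * J * ((P : Matrix n n K) * ((P⁻¹ : GL n K) : Matrix n n K)) * X * (P : Matrix n n K) := by noncomm_ring
    _ = ((P : Matrix n n K).map σ)ᵀ * ((X.map σ)ᵀ * J + J * X) * (P : Matrix n n K) := by rw [h2T, hPP]; noncomm_ring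

/-- **`P⁻¹XP` is `J′`-skew iff `X` is `J`-skew.** [cite: PlatonovRapinchuk1994, §3.3] -/
theorem skew_conj_iff (X : Matrix n n K) :
    ((((P⁻¹ : GL n K) : Matrix n n K) * X * (P : Matrix n n K)).map σ)ᵀ * (((P : Matrix n n K).map σ)ᵀ * J * (P : Matrix n n K)) +
      (((P : Matrix n n K).map σ)ᵀ * J * (P : Matrix n n K)) * (((P⁻¹ : GL n K) : Matrix n n K) * X * (P : Matrix n n K)) = 0 ↔
      (X.map σ)ᵀ * J + J * X = 0 := by
  rw [skew_conj_eq]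
  obtain ⟨-, h2⟩ := map_inv_mul_map σ P
  have h2T : (((P⁻¹ : GL n K) : Matrix n n K).map σ)ᵀ * ((P : Matrix n n K).map σ)ᵀ = 1 := by rw [← Matrix.transpose_mul, h2, Matrix.transpose_one]
  have hPP : (P : Matrix n n K) * ((P⁻¹ : GL n K) : Matrix n n K) = 1 := by rw [← Units.val_mul, mul_inv_cancel, Units.val_one]
  constructor
  · intro h
    have := congrArg (fun Y => (((P⁻¹ : GL n K) : Matrix n n K).map σ)ᵀ * Y * ((P⁻¹ : GL n K) : Matrix n n K)) h
    simp only [mul_zero, zero_mul] at this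
    have e : (((P⁻¹ : GL n K) : Matrix n n K).map σ)ᵀ * (((P : Matrix n n K).map σ)ᵀ * ((X.map σ)ᵀ * J + J * X) * (P : Matrix n n K)) * ((P⁻¹ : GL n K) : Matrix n n K)
        = ((((P⁻¹ : GL n K) : Matrix n n K).map σ)ᵀ * ((P : Matrix n n K).map σ)ᵀ) * ((X.map σ)ᵀ * J + J * X) * ((P : Matrix n n K) * ((P⁻¹ : GL n K) : Matrix n n K)) := by
      noncomm_ring
    rwa [e, h2T, hPP, one_mul, mul_one] at this
  · intro h; rw [h, mul_zero, zero_mul]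

/-- The conjugated unitarity defect: `σ(P⁻¹gP)ᵀ J′ (P⁻¹gP) = σ(P)ᵀ (σ(g)ᵀ J g) P`. [cite: PlatonovRapinchuk1994, §3.3] -/
theorem unitary_conj_eq (g : Matrix n n K) :
    ((((P⁻¹ : GL n K) : Matrix n n K) * g * (P : Matrix n n K)).map σ)ᵀ * (((P : Matrix n n K).map σ)ᵀ * J * (P : Matrix n n K)) *
      (((P⁻¹ : GL n K) : Matrix n n K) * g * (P : Matrix n n K)) = ((P : Matrix n n K).map σ)ᵀ * ((g.map σ)ᵀ * J * g) * (P : Matrix n n K) := by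
  obtain ⟨-, h2⟩ := map_inv_mul_map σ P
  have h2T : (((P⁻¹ : GL n K) : Matrix n n K).map σ)ᵀ * ((P : Matrix n n K).map σ)ᵀ = 1 := by
    rw [← Matrix.transpose_mul, h2, Matrix.transpose_one]
  have hPP : (P : Matrix n n K) * ((P⁻¹ : GL n K) : Matrix n n K) = 1 := by rw [← Units.val_mul, mul_inv_cancel, Units.val_one]
  rw [Matrix.map_mul, Matrix.map_mul, Matrix.transpose_mul, Matrix.transpose_mul]
  calc ((P : Matrix n n K).map σ)ᵀ * ((g.map σ)ᵀ * (((P⁻¹ : GL n K) : Matrix n n K).map σ)ᵀ) * (((P : Matrix n n K).map σ)ᵀ * J * (P : Matrix n n K)) *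
        (((P⁻¹ : GL n K) : Matrix n n K) * g * (P : Matrix n n K))
      = ((P : Matrix n n K).map σ)ᵀ * (g.map σ)ᵀ * ((((P⁻¹ : GL n K) : Matrix n n K).map σ)ᵀ * ((P : Matrix n n K).map σ)ᵀ) * J *
        ((P : Matrix n n K) * ((P⁻¹ : GL n K) : Matrix n n K)) * g * (P : Matrix n n K) := by noncomm_ring
    _ = ((P : Matrix n n K).map σ)ᵀ * ((g.map σ)ᵀ * J * g) * (P : Matrix n n K) := by rw [h2T, hPP]; noncomm_ring

/-- **`P⁻¹gP` is `J′`-unitary iff `g` is `J`-unitary.** [cite: PlatonovRapinchuk1994, §3.3] -/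
theorem unitary_conj_iff (g : Matrix n n K) :
    ((((P⁻¹ : GL n K) : Matrix n n K) * g * (P : Matrix n n K)).map σ)ᵀ * (((P : Matrix n n K).map σ)ᵀ * J * (P : Matrix n n K)) *
      (((P⁻¹ : GL n K) : Matrix n n K) * g * (P : Matrix n n K)) = ((P : Matrix n n K).map σ)ᵀ * J * (P : Matrix n n K) ↔
      (g.map σ)ᵀ * J * g = J := by
  rw [unitary_conj_eq]
  obtain ⟨-, h2⟩ := map_inv_mul_map σ P
  have h2T : (((P⁻¹ : GL n K) : Matrix n n K).map σ)ᵀ * ((P : Matrix n n K).map σ)ᵀ = 1 := by rw [← Matrix.transpose_mul, h2, Matrix.transpose_one]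
  have hPP : (P : Matrix n n K) * ((P⁻¹ : GL n K) : Matrix n n K) = 1 := by rw [← Units.val_mul, mul_inv_cancel, Units.val_one]
  constructor
  · intro h
    have := congrArg (fun Y => (((P⁻¹ : GL n K) : Matrix n n K).map σ)ᵀ * Y * ((P⁻¹ : GL n K) : Matrix n n K)) h
    have key : ∀ Y : Matrix n n K, (((P⁻¹ : GL n K) : Matrix n n K).map σ)ᵀ * (((P : Matrix n n K).map σ)ᵀ * Y * (P : Matrix n n K)) *
        ((P⁻¹ : GL n K) : Matrix n n K) = Y := fun Y => by
      calc _ = ((((P⁻¹ : GL n K) : Matrix n n K).map σ)ᵀ * ((P : Matrix n n K).map σ)ᵀ) * Y * ((P : Matrix n n K) * ((P⁻¹ : GL n K) : Matrix n n K)) := by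
            noncomm_ring
        _ = Y := by rw [h2T, hPP, one_mul, mul_one]
    simpa only [key] using this
  · intro h; rw [h]

end Conj

/-! ## §3 Rational structure, scaling, and a small `σ`-fixed scalar -/

section Rational

variable {K : Type*} [Field K] [CharZero K] {n : Type*} [Fintype n] [DecidableEq n] (σ : K →+* K) (J : Matrix n n K)

/-- **`𝔲(σ,J)` is a `ℚ`-submodule of `M_n(K)`** (`σ` fixes `ℚ`; no definition introduced). [cite: PlatonovRapinchuk1994, §3.3] -/
theorem exists_ratSubmodule_skew : ∃ 𝔲 : Submodule ℚ (Matrix n n K), ∀ X, X ∈ 𝔲 ↔ (X.map σ)ᵀ * J + J * X = 0 := by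
  refine ⟨{ carrier := {X | (X.map σ)ᵀ * J + J * X = 0}, add_mem' := ?_, zero_mem' := ?_, smul_mem' := ?_ }, fun X => Iff.rfl⟩
  · intro a b ha hb
    simp only [mem_setOf_eq] at ha hb ⊢
    rw [Matrix.map_add σ (map_add σ), Matrix.transpose_add, add_mul, mul_add, add_add_add_comm, ha, hb, add_zero]
  · simp
  · intro q X hX
    simp only [mem_setOf_eq] at hX ⊢
    have hq : (q • X).map σ = q • X.map σ := by
      ext i j; simp [Matrix.map_apply, Rat.smul_def, map_ratCast]
    rw [hq, Matrix.transpose_smul, smul_mul_assoc, mul_smul_comm, ← smul_add, hX, smul_zero]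

omit [Fintype n] [DecidableEq n] in
/-- **Scaling by a non-zero rational is an additive automorphism of `𝔲`** acting as the `K`-scalar `q` on matrices. [cite: Serre1992LALG, Part II Ch. IV §9] -/
theorem exists_smul_addEquiv (𝔲 : Submodule ℚ (Matrix n n K)) {q : ℚ} (hq : q ≠ 0) :
    ∃ s : ↥𝔲 ≃+ ↥𝔲, ∀ Z : ↥𝔲, ((s Z : ↥𝔲) : Matrix n n K) = (q : K) • (Z : Matrix n n K) := by
  refine ⟨(LinearEquiv.smulOfUnit (Units.mk0 q hq) : ↥𝔲 ≃ₗ[ℚ] ↥𝔲).toAddEquiv, fun Z => ?_⟩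
  show (((Units.mk0 q hq : ℚˣ) • Z : ↥𝔲) : Matrix n n K) = (q : K) • (Z : Matrix n n K)
  rw [Units.smul_mk0, Submodule.coe_smul]
  ext i j
  simp [Rat.smul_def]

end Rational

section Scalar

variable (K : Type*) [Field K] [ValuativeRel K] [TopologicalSpace K] [IsNonarchimedeanLocalField K] [CharZero K]

/-- **The residue characteristic**: in a characteristic-zero non-archimedean local field there is a natural number `q` with `(q : K) ≠ 0` and `|q|_K < 1`.
[cite: Serre1992LALG, Part II Ch. IV §9] -/
theorem exists_natCast_valuation_lt_one : ∃ q : ℕ, (q : K) ≠ 0 ∧ valuation K (q : K) < 1 := by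
  let q := ringChar 𝓀[K]
  haveI : CharP 𝓀[K] q := ringChar.charP _
  have hq0 : q ≠ 0 := CharP.char_ne_zero_of_finite 𝓀[K] q
  refine ⟨q, Nat.cast_ne_zero.2 hq0, ?_⟩
  have h1 : ¬ IsUnit ((q : 𝒪[K])) := by
    intro hu
    have : IsLocalRing.residue 𝒪[K] (q : 𝒪[K]) = 0 := by rw [map_natCast]; exact CharP.cast_eq_zero _ q
    rw [IsLocalRing.residue_eq_zero_iff] at this
    exact (IsLocalRing.mem_maximalIdeal _).1 this hu
  have := (Valuation.Integer.not_isUnit_iff_valuation_lt_one (x := (q : 𝒪[K]))).1 h1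
  simpa using this

end Scalar

/-! ## §4 Compact subgroups of `GL_n(K)` are conjugate into the integral matrices -/

section Compact

variable {K : Type*} [Field K] [ValuativeRel K] [TopologicalSpace K] [IsNonarchimedeanLocalField K] {n : ℕ}

/-- **A compact subgroup of `GL_n(K)` is conjugate into `GL_n(𝒪_K)`**: there is `P` with `P⁻¹ g P` integral (entries of valuation `≤ 1`) for all `g ∈ C`.
[cite: PlatonovRapinchuk1994, §3.3] -/
theorem exists_conj_valBound_one (C : Subgroup (GL (Fin n) K)) (hC : IsCompact (C : Set (GL (Fin n) K))) :
    ∃ P : GL (Fin n) K, ∀ g ∈ C, ValBound 1 (((P⁻¹ * g * P : GL (Fin n) K)) : Matrix (Fin n) (Fin n) K) := by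
  haveI : CompactSpace C := isCompact_iff_compactSpace.1 hC
  obtain ⟨P, hP⟩ := Literature.NumberTheory.GaloisRepresentations.exists_conj_mem_range_generalLinearGroup_map_of_valuationSubring
    (O := (valuation K).valuationSubring) (Valuation.isOpen_valuationSubring _)
    ({ C.subtype with continuous_toFun := continuous_subtype_val } : C →ₜ* GL (Fin n) K)
  refine ⟨P, fun g hg => ?_⟩
  obtain ⟨g', hg'⟩ := hP ⟨g, hg⟩
  have hg'' : (Matrix.GeneralLinearGroup.map (valuation K).valuationSubring.subtype g' : GL (Fin n) K) = P⁻¹ * g * P := hg'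
  intro i j
  have : ((P⁻¹ * g * P : GL (Fin n) K) : Matrix (Fin n) (Fin n) K) i j = ((g' i j : (valuation K).valuationSubring) : K) := by
    have h := congrArg (fun u : GL (Fin n) K => (u : Matrix (Fin n) (Fin n) K) i j) hg''
    simpa using h.symm
  rw [this]
  exact ((Valuation.mem_valuationSubring_iff _ _).1 (g' i j).2)

end Compact

/-! ## §5 Inside the Cayley window, `cayley W` commutes with `x` only if `W` does -/

section CayleyComm

variable {K : Type*} [Field K] [ValuativeRel K] {n : Type*} [Fintype n] [DecidableEq n]

/-- `cayley W − 1 = 2 W (1 − W)⁻¹` has entries `≤ |2|·α` for `W` with entries `≤ α < 1`. [cite: PlatonovRapinchuk1994, §3.3] -/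
theorem valBound_cayley_sub_one {α : ValueGroupWithZero K} {W : Matrix n n K} (hW : ValBound α W) (hα : α < 1) :
    ValBound (valuation K 2 * α) (cayley W - 1) := by
  obtain ⟨hu, h1, -⟩ := isUnit_det_one_sub_of_valBound hW hα
  rw [cayley_sub_one hu]
  simpa only [mul_one] using valBound_smul (2 : K) (hW.mul h1)

/-- **If `cayley W` (with `W` `J`-skew in the window) is `J`-unitary and commutes with `x`, then `W` commutes with `x`** (★ Q3 `exists_skew_cayley_eq_of_le` + ★ C2
`eq_of_cayley_eq_cayley`). [cite: PlatonovRapinchuk1994, §3.3] -/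
theorem comm_of_cayley_comm (σ : K →+* K) (h2 : (2 : K) ≠ 0) {J x W : Matrix n n K} {α : ValueGroupWithZero K} (hW : ValBound α W) (hα : α < 1)
    (hU : ((cayley W).map σ)ᵀ * J * cayley W = J) (hcomm : cayley W * x = x * cayley W) : W * x = x * W := by
  have h2v : valuation K 2 ≠ 0 := by rwa [Ne, map_eq_zero]
  have hβ : valuation K 2 * α < valuation K 2 := mul_lt_of_lt_one_right (zero_lt_iff.2 h2v) hα
  obtain ⟨X, -, hXx, hXb, -, hcay⟩ := exists_skew_cayley_eq_of_le σ hU hcomm (valBound_cayley_sub_one hW hα) hβ le_rfl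
  rw [← eq_of_cayley_eq_cayley h2 hXb hW hα hcay]
  exact hXx

end CayleyComm

end Summit.HodgeConjecture.HodgeConjecture.Cruxes.H413.F0P3cStCharTSJacCartanModelFrame
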